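import Mathlib
import Summits.ValiantsHypothesis.ValiantsHypothesis.Theorems.ElementaryWordLengthWordLengthQPStubInversionCost
import Summits.ValiantsHypothesis.ValiantsHypothesis.Theorems.ElementaryWordLengthWordLengthQPUnivariateSandwich

/-!
# Crux `WordLengthQP` (stmt-ValiantsHypothesis-6623), line `positive-monoid-exits` —
THEOREM U, part 3/3: `b(E₀₂(c t^d)) ≤ 3` and `κ₁(t^d) ≤ 16` for all `d` (lead c6)

* `univariate_sandwich`: for `d ≥ 1`, real `c`: positive adjacent words `Q₁, R, Q₂` with
  `R = Q₁ · E₀₂(c t^d) · Q₂` (explicitly: all-`t` walk of `2q+1` double steps, `q = (d-1)/2`, taps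
  `|c| C(2q+1, m)` resp. `· t`, split by sign between `R` and `Q₁, Q₂`).
* `stub_univariateBoundedExits` (registered calibration stub): for every `d` a valid real word for `E₀₂(t^d)` with `≤ 16` exits
  (`Q₁⁻¹, Q₂⁻¹` by the 8-exit inversion `stub_inversionCost`; `d = 0` by the commutator
  `[x₁(1), x₂(1)]`).
* `not_univariate_exits_unbounded`: the hypothesis `H` of the skeleton's
  `monomialExitLadder_of_univariate` is FALSE — the univariate exit numbers are bounded by `16`
  (rung 2 gives `≥ 3` for `d ≥ 3`); the tables `κ₁(t³) = 5` (length ≤ 10), "no word of length ≤ 10 for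
  `t⁴, t⁵, t⁶`" (kit j021072) were artefacts of the length bound: the witnesses here have length `≈ 4.5 d + 48`.
Consequence for the line: total nonnegativity plus degree-1 letters does not see DEGREE in one
variable; `stub_univariateReduction` / `stub_restriction` can never certify more than 16 exits for
`E₀₂(per_n)`; the bet `S` (sign budget) needs a genuinely multivariate invariant.

Vocabulary (written out in every statement; the files introduce NO definitions): the letter matrix
of `l = (i, j, c, o)` is `Matrix.transvection i j (C c * o.elim 1 X)` (the route's word predicate over
`σ = Fin 1`, `t = X 0`); a letter is POSITIVE ADJACENT (not an exit) iff `0 < c ∧ |i - j| = 1`; the TAPS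
at a state are the letters `x₂(a) = (1,2,a,none)`, `x₂(b t) = (1,2,b,some 0)` written only when `a > 0`,
`b > 0`; a TAP WORD with `K` double steps is `taps(0) ++ ⋯ ++ [x₁(t)] ++ taps(k+1) ++ [y₁(t)] ++ ⋯`
(`x₁(t) = (0,1,1,some 0)`, `y₁(t) = (1,0,1,some 0)`); the WALK MATRIX is `(x₁(t) y₁(t))^K`; the GARBAGE
COLUMN of a vector `v` is `vecMulVec v e₂`; the continuant STATE SEQUENCE is any
`W : ℕ → Fin 3 → ℝ[t]` with `W 0 = e₁, W 1 = e₀, W (n+2) = W n + t • W (n+1)` (hypothesis `hW`).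

[folklore]
-/

-- `Summit.ValiantsHypothesis.ValiantsHypothesis.…` is the tree's mandated single-conjunct layout
-- (Sub = Summit), so the duplicated namespace component is intended.
set_option linter.dupNamespace false

noncomputable section

namespace Summit.ValiantsHypothesis.ValiantsHypothesis.Cruxes.WordLengthQP.PositiveMonoidExits

open Matrix

section Assembly

/-- **THEOREM U (sandwich form).** For every `d ≥ 1` and real `c` there are POSITIVE adjacent words
`Q₁, R, Q₂` (letters `x₁(t), y₁(t), x₂(a), x₂(a t)`, `a > 0`) with `R = Q₁ · E₀₂(c t^d) · Q₂`, i.e.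
`E₀₂(c t^d) ∈ 𝒫⁻¹ 𝒫 𝒫⁻¹` has alternation number at most `3` for ALL `d` (parabolic submodel, all-`t` walk,
binomial taps).  Lead c6 of line `positive-monoid-exits`. [folklore] -/
theorem univariate_sandwich (d : ℕ) (hd : 1 ≤ d) (c : ℝ) :
    ∃ Q₁ R Q₂ : List (Fin 3 × Fin 3 × ℝ × Option (Fin 1)),
      (∀ l ∈ Q₁, (0 < l.2.2.1 ∧ (l.1.val + 1 = l.2.1.val ∨ l.2.1.val + 1 = l.1.val))) ∧ (∀ l ∈ R, (0 < l.2.2.1 ∧ (l.1.val + 1 = l.2.1.val ∨ l.2.1.val + 1 = l.1.val))) ∧ (∀ l ∈ Q₂, (0 < l.2.2.1 ∧ (l.1.val + 1 = l.2.1.val ∨ l.2.1.val + 1 = l.1.val))) ∧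
      (R.map (fun l : Fin 3 × Fin 3 × ℝ × Option (Fin 1) =>
      Matrix.transvection l.1 l.2.1 (MvPolynomial.C l.2.2.1 * l.2.2.2.elim 1 MvPolynomial.X))).prod =
        (Q₁.map (fun l : Fin 3 × Fin 3 × ℝ × Option (Fin 1) =>
      Matrix.transvection l.1 l.2.1 (MvPolynomial.C l.2.2.1 * l.2.2.2.elim 1 MvPolynomial.X))).prod * Matrix.transvection 0 2 (MvPolynomial.C c * (MvPolynomial.X (0 : Fin 1) : MvPolynomial (Fin 1) ℝ) ^ d) * (Q₂.map (fun l : Fin 3 × Fin 3 × ℝ × Option (Fin 1) =>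
      Matrix.transvection l.1 l.2.1 (MvPolynomial.C l.2.2.1 * l.2.2.2.elim 1 MvPolynomial.X))).prod := by
  -- the continuant state sequence of the all-`t` walk, as a term
  obtain ⟨W, hW⟩ : ∃ W : ℕ → Fin 3 → MvPolynomial (Fin 1) ℝ, W 0 = Pi.single 1 1 ∧ W 1 = Pi.single 0 1 ∧
      ∀ n, W (n + 2) = W n + (MvPolynomial.X (0 : Fin 1) : MvPolynomial (Fin 1) ℝ) • W (n + 1) :=
    ⟨fun n => (Nat.rec (motive := fun _ => (Fin 3 → MvPolynomial (Fin 1) ℝ) × (Fin 3 → MvPolynomial (Fin 1) ℝ))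
        ((Pi.single 1 1 : Fin 3 → MvPolynomial (Fin 1) ℝ), (Pi.single 0 1 : Fin 3 → MvPolynomial (Fin 1) ℝ))
        (fun _ p => (p.2, p.1 + (MvPolynomial.X (0 : Fin 1) : MvPolynomial (Fin 1) ℝ) • p.2)) n).1,
      rfl, rfl, fun n => rfl⟩
  set q := (d - 1) / 2 with hq
  set a := 2 * q + 1 with ha
  have hda : d = a ∨ d = a + 1 := by omega
  rcases hda with hda | hda
  · -- odd case: constant taps
    set σ0 : ℕ → ℝ := fun m => c * ((-1 : ℝ) ^ (a + m) * (a.choose m : ℝ))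
    set σ1 : ℕ → ℝ := 0
    refine ⟨(((if (0 : ℝ) < (σ0⁻ 0) then [((1 : Fin 3), (2 : Fin 3), ((σ0⁻ 0) : ℝ), (none : Option (Fin 1)))] else []) ++
        (if (0 : ℝ) < (σ1⁻ 0) then [((1 : Fin 3), (2 : Fin 3), ((σ1⁻ 0) : ℝ), some (0 : Fin 1))] else [])) ++
      (List.range (q)).flatMap (fun k =>
        [((0 : Fin 3), (1 : Fin 3), (1 : ℝ), some (0 : Fin 1))] ++
        ((if (0 : ℝ) < (σ0⁻ (k + 1)) then [((1 : Fin 3), (2 : Fin 3), ((σ0⁻ (k + 1)) : ℝ), (none : Option (Fin 1)))] else []) ++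
        (if (0 : ℝ) < (σ1⁻ (k + 1)) then [((1 : Fin 3), (2 : Fin 3), ((σ1⁻ (k + 1)) : ℝ), some (0 : Fin 1))] else [])) ++
        [((1 : Fin 3), (0 : Fin 3), (1 : ℝ), some (0 : Fin 1))])), (((if (0 : ℝ) < (σ0⁺ 0) then [((1 : Fin 3), (2 : Fin 3), ((σ0⁺ 0) : ℝ), (none : Option (Fin 1)))] else []) ++
        (if (0 : ℝ) < (σ1⁺ 0) then [((1 : Fin 3), (2 : Fin 3), ((σ1⁺ 0) : ℝ), some (0 : Fin 1))] else [])) ++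
      (List.range (q + (q + 1))).flatMap (fun k =>
        [((0 : Fin 3), (1 : Fin 3), (1 : ℝ), some (0 : Fin 1))] ++
        ((if (0 : ℝ) < (σ0⁺ (k + 1)) then [((1 : Fin 3), (2 : Fin 3), ((σ0⁺ (k + 1)) : ℝ), (none : Option (Fin 1)))] else []) ++
        (if (0 : ℝ) < (σ1⁺ (k + 1)) then [((1 : Fin 3), (2 : Fin 3), ((σ1⁺ (k + 1)) : ℝ), some (0 : Fin 1))] else [])) ++
        [((1 : Fin 3), (0 : Fin 3), (1 : ℝ), some (0 : Fin 1))])),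
      (((if (0 : ℝ) < ((fun m => if m = 0 then 0 else (σ0⁻) (q + m)) 0) then [((1 : Fin 3), (2 : Fin 3), (((fun m => if m = 0 then 0 else (σ0⁻) (q + m)) 0) : ℝ), (none : Option (Fin 1)))] else []) ++
        (if (0 : ℝ) < ((fun m => if m = 0 then 0 else (σ1⁻) (q + m)) 0) then [((1 : Fin 3), (2 : Fin 3), (((fun m => if m = 0 then 0 else (σ1⁻) (q + m)) 0) : ℝ), some (0 : Fin 1))] else [])) ++
      (List.range (q + 1)).flatMap (fun k =>
        [((0 : Fin 3), (1 : Fin 3), (1 : ℝ), some (0 : Fin 1))] ++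
        ((if (0 : ℝ) < ((fun m => if m = 0 then 0 else (σ0⁻) (q + m)) (k + 1)) then [((1 : Fin 3), (2 : Fin 3), (((fun m => if m = 0 then 0 else (σ0⁻) (q + m)) (k + 1)) : ℝ), (none : Option (Fin 1)))] else []) ++
        (if (0 : ℝ) < ((fun m => if m = 0 then 0 else (σ1⁻) (q + m)) (k + 1)) then [((1 : Fin 3), (2 : Fin 3), (((fun m => if m = 0 then 0 else (σ1⁻) (q + m)) (k + 1)) : ℝ), some (0 : Fin 1))] else [])) ++
        [((1 : Fin 3), (0 : Fin 3), (1 : ℝ), some (0 : Fin 1))])),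
      utword_posadj (σ0⁻) (σ1⁻) q, utword_posadj (σ0⁺) (σ1⁺) (q + (q + 1)),
      utword_posadj (fun m => if m = 0 then 0 else (σ0⁻) (q + m)) (fun m => if m = 0 then 0 else (σ1⁻) (q + m))
        (q + 1), ?_⟩
    refine stub_univariateSandwichIdentity W hW (σ0⁺) (σ1⁺) (σ0⁻) (σ1⁻) (fun m => if m = 0 then 0 else (σ0⁻) (q + m))
      (fun m => if m = 0 then 0 else (σ1⁻) (q + m))
      (fun m => posPart_nonneg _) (fun m => posPart_nonneg _)
      (fun m => negPart_nonneg _) (fun m => negPart_nonneg _)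
      (fun m => by split_ifs; exact le_rfl; exact negPart_nonneg _)
      (fun m => by split_ifs; exact le_rfl; exact negPart_nonneg _) q (q + 1)
      (MvPolynomial.C c * (MvPolynomial.X (0 : Fin 1) : MvPolynomial (Fin 1) ℝ) ^ d) ?_
    rw [usplit W hW, show q + (q + 1) = a by omega, show 2 * q + 1 = a by omega, hda, utarget_odd W hW]
  · -- even case: taps of degree one
    set σ0 : ℕ → ℝ := 0
    set σ1 : ℕ → ℝ := fun m => c * ((-1 : ℝ) ^ (a + m) * (a.choose m : ℝ))
    refine ⟨(((if (0 : ℝ) < (σ0⁻ 0) then [((1 : Fin 3), (2 : Fin 3), ((σ0⁻ 0) : ℝ), (none : Option (Fin 1)))] else []) ++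
        (if (0 : ℝ) < (σ1⁻ 0) then [((1 : Fin 3), (2 : Fin 3), ((σ1⁻ 0) : ℝ), some (0 : Fin 1))] else [])) ++
      (List.range (q)).flatMap (fun k =>
        [((0 : Fin 3), (1 : Fin 3), (1 : ℝ), some (0 : Fin 1))] ++
        ((if (0 : ℝ) < (σ0⁻ (k + 1)) then [((1 : Fin 3), (2 : Fin 3), ((σ0⁻ (k + 1)) : ℝ), (none : Option (Fin 1)))] else []) ++
        (if (0 : ℝ) < (σ1⁻ (k + 1)) then [((1 : Fin 3), (2 : Fin 3), ((σ1⁻ (k + 1)) : ℝ), some (0 : Fin 1))] else [])) ++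
        [((1 : Fin 3), (0 : Fin 3), (1 : ℝ), some (0 : Fin 1))])), (((if (0 : ℝ) < (σ0⁺ 0) then [((1 : Fin 3), (2 : Fin 3), ((σ0⁺ 0) : ℝ), (none : Option (Fin 1)))] else []) ++
        (if (0 : ℝ) < (σ1⁺ 0) then [((1 : Fin 3), (2 : Fin 3), ((σ1⁺ 0) : ℝ), some (0 : Fin 1))] else [])) ++
      (List.range (q + (q + 1))).flatMap (fun k =>
        [((0 : Fin 3), (1 : Fin 3), (1 : ℝ), some (0 : Fin 1))] ++
        ((if (0 : ℝ) < (σ0⁺ (k + 1)) then [((1 : Fin 3), (2 : Fin 3), ((σ0⁺ (k + 1)) : ℝ), (none : Option (Fin 1)))] else []) ++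
        (if (0 : ℝ) < (σ1⁺ (k + 1)) then [((1 : Fin 3), (2 : Fin 3), ((σ1⁺ (k + 1)) : ℝ), some (0 : Fin 1))] else [])) ++
        [((1 : Fin 3), (0 : Fin 3), (1 : ℝ), some (0 : Fin 1))])),
      (((if (0 : ℝ) < ((fun m => if m = 0 then 0 else (σ0⁻) (q + m)) 0) then [((1 : Fin 3), (2 : Fin 3), (((fun m => if m = 0 then 0 else (σ0⁻) (q + m)) 0) : ℝ), (none : Option (Fin 1)))] else []) ++
        (if (0 : ℝ) < ((fun m => if m = 0 then 0 else (σ1⁻) (q + m)) 0) then [((1 : Fin 3), (2 : Fin 3), (((fun m => if m = 0 then 0 else (σ1⁻) (q + m)) 0) : ℝ), some (0 : Fin 1))] else [])) ++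
      (List.range (q + 1)).flatMap (fun k =>
        [((0 : Fin 3), (1 : Fin 3), (1 : ℝ), some (0 : Fin 1))] ++
        ((if (0 : ℝ) < ((fun m => if m = 0 then 0 else (σ0⁻) (q + m)) (k + 1)) then [((1 : Fin 3), (2 : Fin 3), (((fun m => if m = 0 then 0 else (σ0⁻) (q + m)) (k + 1)) : ℝ), (none : Option (Fin 1)))] else []) ++
        (if (0 : ℝ) < ((fun m => if m = 0 then 0 else (σ1⁻) (q + m)) (k + 1)) then [((1 : Fin 3), (2 : Fin 3), (((fun m => if m = 0 then 0 else (σ1⁻) (q + m)) (k + 1)) : ℝ), some (0 : Fin 1))] else [])) ++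
        [((1 : Fin 3), (0 : Fin 3), (1 : ℝ), some (0 : Fin 1))])),
      utword_posadj (σ0⁻) (σ1⁻) q, utword_posadj (σ0⁺) (σ1⁺) (q + (q + 1)),
      utword_posadj (fun m => if m = 0 then 0 else (σ0⁻) (q + m)) (fun m => if m = 0 then 0 else (σ1⁻) (q + m))
        (q + 1), ?_⟩
    refine stub_univariateSandwichIdentity W hW (σ0⁺) (σ1⁺) (σ0⁻) (σ1⁻) (fun m => if m = 0 then 0 else (σ0⁻) (q + m))
      (fun m => if m = 0 then 0 else (σ1⁻) (q + m))
      (fun m => posPart_nonneg _) (fun m => posPart_nonneg _)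
      (fun m => negPart_nonneg _) (fun m => negPart_nonneg _)
      (fun m => by split_ifs; exact le_rfl; exact negPart_nonneg _)
      (fun m => by split_ifs; exact le_rfl; exact negPart_nonneg _) q (q + 1)
      (MvPolynomial.C c * (MvPolynomial.X (0 : Fin 1) : MvPolynomial (Fin 1) ℝ) ^ d) ?_
    rw [usplit W hW, show q + (q + 1) = a by omega, show 2 * q + 1 = a by omega, hda, utarget_even W hW]

/-- The exit filter of a positive adjacent word is empty. [folklore] -/
theorem ufilter_posadj (w : List (Fin 3 × Fin 3 × ℝ × Option (Fin 1))) (hw : ∀ l ∈ w, (0 < l.2.2.1 ∧ (l.1.val + 1 = l.2.1.val ∨ l.2.1.val + 1 = l.1.val))) :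
    (w.filter (fun l => !decide (0 < l.2.2.1 ∧
      (l.1.val + 1 = l.2.1.val ∨ l.2.1.val + 1 = l.1.val)))).length = 0 := by
  rw [List.length_eq_zero_iff, List.filter_eq_nil_iff]
  intro l hl
  have h := hw l hl
  simp [h]

/-- `E₀₂(1) = x₁(1) x₂(1) x₁(-1) x₂(-1)` (two exits). [folklore] -/
theorem uE02_one :
    Matrix.transvection (0 : Fin 3) 1 (1 : (MvPolynomial (Fin 1) ℝ)) * (Matrix.transvection (1 : Fin 3) 2 (1 : (MvPolynomial (Fin 1) ℝ)) *
      (Matrix.transvection (0 : Fin 3) 1 (-1 : (MvPolynomial (Fin 1) ℝ)) * Matrix.transvection (1 : Fin 3) 2 (-1 : (MvPolynomial (Fin 1) ℝ)))) =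
    Matrix.transvection (0 : Fin 3) 2 1 := by
  ext i j
  fin_cases i <;> fin_cases j <;>
    simp [Matrix.transvection, Matrix.mul_apply, Fin.sum_univ_three, Matrix.single,
      Matrix.of_apply, Matrix.one_apply]

/-- **THEOREM U (exit form): at most 16 exits for every univariate monomial transvection.**
For every `d` there is a valid real word over one variable computing `E₀₂(t^d)` with at most `16`
exits (for `d ≥ 1`: `h Q₁^{rev} h · R · h Q₂^{rev} h` with the sandwich `R = Q₁ E₀₂(t^d) Q₂` of
`univariate_sandwich` and the 8-exit inversion of `stub_inversionCost`; for `d = 0`: the commutator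
`[x₁(1), x₂(1)]`).  So the exit number `κ₁(t^d)` is bounded (between `3`, rung 2, and `16`); the
univariate tables `κ₁(t) = 1, κ₁(t²) = 2, κ₁(t³) = 5 (length ≤ 10)` do not grow beyond `16`.
Lead c6 of line `positive-monoid-exits`. [folklore] -/
theorem stub_univariateBoundedExits (d : ℕ) :
    ∃ w₁ : List (Fin 3 × Fin 3 × ℝ × Option (Fin 1)), (∀ l ∈ w₁, l.1 ≠ l.2.1) ∧
      (w₁.map (fun l => Matrix.transvection l.1 l.2.1
        (MvPolynomial.C l.2.2.1 * l.2.2.2.elim 1 MvPolynomial.X))).prod =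
        Matrix.transvection (0 : Fin 3) 2 ((MvPolynomial.X 0 : MvPolynomial (Fin 1) ℝ) ^ d) ∧
      (w₁.filter (fun l => !decide (0 < l.2.2.1 ∧
          (l.1.val + 1 = l.2.1.val ∨ l.2.1.val + 1 = l.1.val)))).length ≤ 16 := by
  rcases Nat.eq_zero_or_pos d with hd | hd
  · subst hd
    refine ⟨[((0 : Fin 3), (1 : Fin 3), (1 : ℝ), (none : Option (Fin 1))), (1, 2, 1, none),
      (0, 1, -1, none), (1, 2, -1, none)], ?_, ?_, ?_⟩
    · intro l hl
      fin_cases hl <;> simp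
    · simp only [List.map_cons, List.map_nil, List.prod_cons, List.prod_nil, mul_one,
        Option.elim_none, map_one, map_neg, pow_zero]
      exact uE02_one
    · norm_num [List.filter_cons]
  · obtain ⟨Q₁, R, Q₂, hQ₁, hR, hQ₂, hprod⟩ := univariate_sandwich d hd 1
    have hv1 : ∀ l ∈ Q₁, l.1 ≠ l.2.1 := fun l hl => uposadj_valid l (hQ₁ l hl)
    have hv2 : ∀ l ∈ Q₂, l.1 ≠ l.2.1 := fun l hl => uposadj_valid l (hQ₂ l hl)
    have hvR : ∀ l ∈ R, l.1 ≠ l.2.1 := fun l hl => uposadj_valid l (hR l hl)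
    obtain ⟨Q₁', hv1', hinv1, hex1, -⟩ := stub_inversionCost Q₁ hv1
    obtain ⟨Q₂', hv2', hinv2, hex2, -⟩ := stub_inversionCost Q₂ hv2
    refine ⟨Q₁' ++ R ++ Q₂', ?_, ?_, ?_⟩
    · intro l hl
      simp only [List.mem_append] at hl
      rcases hl with (hl | hl) | hl
      · exact hv1' l hl
      · exact hvR l hl
      · exact hv2' l hl
    · have hinv2' := mul_eq_one_comm.mp hinv2
      rw [List.map_append, List.map_append, List.prod_append, List.prod_append]
      have hR' : (R.map (fun l : Fin 3 × Fin 3 × ℝ × Option (Fin 1) =>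
      Matrix.transvection l.1 l.2.1 (MvPolynomial.C l.2.2.1 * l.2.2.2.elim 1 MvPolynomial.X))).prod = (Q₁.map (fun l : Fin 3 × Fin 3 × ℝ × Option (Fin 1) =>
      Matrix.transvection l.1 l.2.1 (MvPolynomial.C l.2.2.1 * l.2.2.2.elim 1 MvPolynomial.X))).prod *
          Matrix.transvection 0 2 ((MvPolynomial.X 0 : MvPolynomial (Fin 1) ℝ) ^ d) * (Q₂.map (fun l : Fin 3 × Fin 3 × ℝ × Option (Fin 1) =>
      Matrix.transvection l.1 l.2.1 (MvPolynomial.C l.2.2.1 * l.2.2.2.elim 1 MvPolynomial.X))).prod := by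
        have := hprod
        simp only [map_one, one_mul] at this
        exact this
      rw [hR']
      calc (Q₁'.map (fun l : Fin 3 × Fin 3 × ℝ × Option (Fin 1) =>
      Matrix.transvection l.1 l.2.1 (MvPolynomial.C l.2.2.1 * l.2.2.2.elim 1 MvPolynomial.X))).prod * ((Q₁.map (fun l : Fin 3 × Fin 3 × ℝ × Option (Fin 1) =>
      Matrix.transvection l.1 l.2.1 (MvPolynomial.C l.2.2.1 * l.2.2.2.elim 1 MvPolynomial.X))).prod *
              Matrix.transvection 0 2 ((MvPolynomial.X 0 : MvPolynomial (Fin 1) ℝ) ^ d) *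
             (Q₂.map (fun l : Fin 3 × Fin 3 × ℝ × Option (Fin 1) =>
      Matrix.transvection l.1 l.2.1 (MvPolynomial.C l.2.2.1 * l.2.2.2.elim 1 MvPolynomial.X))).prod) * (Q₂'.map (fun l : Fin 3 × Fin 3 × ℝ × Option (Fin 1) =>
      Matrix.transvection l.1 l.2.1 (MvPolynomial.C l.2.2.1 * l.2.2.2.elim 1 MvPolynomial.X))).prod
          = ((Q₁'.map (fun l : Fin 3 × Fin 3 × ℝ × Option (Fin 1) =>
      Matrix.transvection l.1 l.2.1 (MvPolynomial.C l.2.2.1 * l.2.2.2.elim 1 MvPolynomial.X))).prod * (Q₁.map (fun l : Fin 3 × Fin 3 × ℝ × Option (Fin 1) =>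
      Matrix.transvection l.1 l.2.1 (MvPolynomial.C l.2.2.1 * l.2.2.2.elim 1 MvPolynomial.X))).prod) *
            Matrix.transvection 0 2 ((MvPolynomial.X 0 : MvPolynomial (Fin 1) ℝ) ^ d) *
            ((Q₂.map (fun l : Fin 3 × Fin 3 × ℝ × Option (Fin 1) =>
      Matrix.transvection l.1 l.2.1 (MvPolynomial.C l.2.2.1 * l.2.2.2.elim 1 MvPolynomial.X))).prod * (Q₂'.map (fun l : Fin 3 × Fin 3 × ℝ × Option (Fin 1) =>
      Matrix.transvection l.1 l.2.1 (MvPolynomial.C l.2.2.1 * l.2.2.2.elim 1 MvPolynomial.X))).prod) := by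
            simp only [mul_assoc]
        _ = Matrix.transvection 0 2 ((MvPolynomial.X 0 : MvPolynomial (Fin 1) ℝ) ^ d) := by
            rw [hinv1, hinv2', one_mul, mul_one]
    · rw [List.filter_append, List.filter_append, List.length_append, List.length_append,
        ufilter_posadj R hR]
      have e1 := ufilter_posadj Q₁ hQ₁
      have e2 := ufilter_posadj Q₂ hQ₂
      simp only [e1] at hex1
      simp only [e2] at hex2
      omega

/-- **The univariate shadow of the monomial ladder is FALSE.**  Hypothesis `H` of the skeleton's
`monomialExitLadder_of_univariate` ("for every `k` some power `t^d` needs more than `k` exits in the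
univariate arena") fails at `k = 16`: every `E₀₂(t^d)` has a valid word with at most `16` exits.
Hence the 0/1-restriction / univariate-reduction route (`stub_univariateReduction`,
`stub_restriction`) never certifies more than `16` exits for `E₀₂(per_n)`; any lower bound for
the sign budget `S` above `16` must be genuinely multivariate.  Lead c6. [folklore] -/
theorem not_univariate_exits_unbounded :
    ¬ (∀ k : ℕ, ∃ d : ℕ, ∀ w₁ : List (Fin 3 × Fin 3 × ℝ × Option (Fin 1)),
      (∀ l ∈ w₁, l.1 ≠ l.2.1) →
      (w₁.map (fun l => Matrix.transvection l.1 l.2.1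
        (MvPolynomial.C l.2.2.1 * l.2.2.2.elim 1 MvPolynomial.X))).prod =
        Matrix.transvection (0 : Fin 3) 2 ((MvPolynomial.X 0 : MvPolynomial (Fin 1) ℝ) ^ d) →
      k < (w₁.filter (fun l => !decide (0 < l.2.2.1 ∧
          (l.1.val + 1 = l.2.1.val ∨ l.2.1.val + 1 = l.1.val)))).length) := by
  intro h
  obtain ⟨d, hd⟩ := h 16
  obtain ⟨w₁, hv, hp, hle⟩ := stub_univariateBoundedExits d
  exact absurd (hd w₁ hv hp) (not_lt.mpr hle)

end Assembly

end Summit.ValiantsHypothesis.ValiantsHypothesis.Cruxes.WordLengthQP.PositiveMonoidExits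

end
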